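import Summits.CriticalPhenomena.PercolationContinuityZ3.Theorems.Transplant.KNCells2ChainAdvR
import Summits.CriticalPhenomena.PercolationContinuityZ3.Theorems.Transplant.KNCells2AdvPackaging
import HarnessLib

/-!
# The ROOTED straight-run chain of `X □ ℤ²` as target steps in a tube graph: the data `TubeAdvData` (KNCellsBoxProdZ2ChainTA) read with
# the rooted regions `Adv.regionR` (KNCells2ChainAdvR) — steps `stepAR`, regions `stepDR = π × regionR_k`, the kits, the planar room and the
# transfer of the chain to a dominating event (the elongated deep route of a face-step contact, p3-g2's `advRoute_of_contact`)

builds on p205010 (kernel theorem, internal audit signed; external expert review pending) — nothing in this file uses p205010.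
Lane `prim-bschramm`, seat `prim-bschramm-p2` (advRoute_of_contact, part 2); helper file (`--supports stmt-CriticalPhenomena-4575`).

* `TubeAdvData.aregionR / stepDR / stepAR`; `enclR`, `coreT_subset_stepDR`, `coreER_subset_stepDR`, `stepDR_subset_prism`, **`kitsAt_stepAR`**
  (p3-g2's `kitClauseQ` / `hkits_tube` verbatim), **`roomR`** (`hroom` verbatim, `ℓ₁ ≥ 2q + s₁ + R'`), **`lt_real_of_advRChain`** (the chain of
  `nA + 1` rooted steps under any weighting of the tube graph transferred to a dominating event: `1 - ε'' < μA`).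
[cite: KozmaNitzan2024, §4 Lemma 10 (p. 17), Lemma 11 (pp. 22–23), Lemma 12 (pp. 23–25), p. 20 (Step IV)]
-/

noncomputable section

open MeasureTheory ProbabilityTheory
open scoped ENNReal

namespace Summit.CriticalPhenomena.PercolationContinuityZ3.Theorems

namespace Transplant

namespace BoxProdZ2

open Literature.Probability.Percolation Literature.Probability.LatticeModels SimpleGraph
open Literature.Probability.Percolation.KozmaNitzan
open Literature.Probability.Percolation.KozmaNitzan.Cells (sgOf sgOf_sign)
open KNLevels ChainPlanar

variable {W : Type} [DecidableEq W] (X : SimpleGraph W) [X.LocallyFinite]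

namespace TubeAdvData

variable {X} (P : TubeAdvData W)

/-- The rooted planar region `k`. [folklore] -/
def aregionR (k : ℕ) : Finset (Site 2) := Adv.regionR P.q P.s₁ P.ρ P.R' P.ax P.sg P.c k

/-- **The rooted region of step `k`**: `π × regionR_k`. [cite: KozmaNitzan2024, §4 Lemma 10 (p. 17: D)] -/
def stepDR (k : ℕ) : Finset (W × Site 2) := P.π ×ˢ P.aregionR k

variable (X)

/-- **Step `k` of the rooted run as a target step** (same levels and enlarged target as `stepA`, rooted region). [cite: KozmaNitzan2024, §4 Lemma 11] -/
def stepAR (k : ℕ) : TStep (tubeGraph X P.π) := ⟨P.stepL X k, P.stepDR k, P.coreE k, P.Rlev, P.N, P.j₀, P.j₁⟩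

omit [X.LocallyFinite] in
/-- The true targets link the rooted chain. [folklore] -/
theorem coreT_subset_XR_zero_succ (hsg : P.sg = 1 ∨ P.sg = -1) (k : ℕ) : P.coreT k ⊆ (P.stepAR X (k + 1)).L.X 0 :=
  P.coreT_subset_X_zero_succ X hsg k

omit [X.LocallyFinite] in
/-- The true target lies in the enlarged target. [folklore] -/
theorem coreT_subset_coreER (k : ℕ) : P.coreT k ⊆ (P.stepAR X k).T := Finset.subset_union_left

omit [X.LocallyFinite] in
/-- The excess part of the enlarged target is inside the rim part. [folklore] -/
theorem coreER_sdiff_subset (k : ℕ) : (P.stepAR X k).T \ P.coreT k ⊆ P.Rim k := P.coreE_sdiff_subset X k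

omit [X.LocallyFinite] in
/-- The sources agree. [folklore] -/
theorem stepAR_o (k : ℕ) : (P.stepAR X k).L.o = P.root := rfl

variable {P}
variable (hsg : P.sg = 1 ∨ P.sg = -1) (hOK : Adv.AdvOK P.q P.q' P.s₁ P.ρ P.R' P.ℓ₀ P.nA)
include hsg hOK

omit [DecidableEq W] [X.LocallyFinite] in
/-- **`X^{(k)}_{Rlev+1} ⊆ DR_k`** when `Rlev + 1 ≤ R'` (`k ≤ nA`). [cite: KozmaNitzan2024, §4 Lemma 10 (p. 17: B⟨R+1⟩ ⊆ D)] -/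
theorem enclR (hRl : P.Rlev + 1 ≤ P.R') {k : ℕ} (hk : k ≤ P.nA) : (P.stepL X k).X (P.Rlev + 1) ⊆ P.stepDR k := by
  rw [P.stepL_X X hsg, stepDR]
  refine Finset.product_subset_product_right
    ((sBox_mono hsg _ ?_ ?_ ?_).trans (Adv.enlarge_core_subset_regionR hsg P.c hOK hk)) <;> push_cast <;> omega

omit [DecidableEq W] [X.LocallyFinite] in
/-- **`T'_k ⊆ DR_k`** (`k ≤ nA`). [folklore] -/
theorem coreT_subset_stepDR {k : ℕ} (hk : k ≤ P.nA) : P.coreT k ⊆ P.stepDR k :=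
  Finset.product_subset_product_right (Adv.core_succ_subset_regionR hsg P.c hOK hk)

omit [X.LocallyFinite] in
/-- **`T_k ⊆ DR_k`** when the rim part lies in the rooted region. [folklore] -/
theorem coreER_subset_stepDR (hRim : ∀ k, P.Rim k ⊆ P.stepDR k) {k : ℕ} (hk : k ≤ P.nA) : P.coreE k ⊆ P.stepDR k :=
  Finset.union_subset (coreT_subset_stepDR hsg hOK hk) (hRim k)

omit [DecidableEq W] [X.LocallyFinite] in
/-- **`DR_k` lies in the prism** `π × {-(3q + s₁ + 2R') ≤ level ≤ q + (nA+1)s₁, |trans| ≤ ρ}`. [cite: KozmaNitzan2024, §4 Lemma 11 (p. 22: Ω)] -/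
theorem stepDR_subset_prism {k : ℕ} (hk : k ≤ P.nA) :
    P.stepDR k ⊆ P.π ×ˢ sBox P.ax P.sg P.c (-(Adv.ρ₀ P.q P.s₁ P.R')) (P.q + ((P.nA : ℤ) + 1) * P.s₁) P.ρ :=
  Finset.product_subset_product_right (Adv.regionR_subset_prism hsg P.c hOK hk)

/-- **`KitsAt` of the rooted step `k`** (`k ≤ nA`; p3-g2's kit clause verbatim). [cite: KozmaNitzan2024, §4 Lemma 10 (p. 17)] -/
theorem kitsAt_stepAR (hRl : P.Rlev + 1 ≤ P.R') (hRim : ∀ k, P.Rim k ⊆ P.stepDR k) (hπ : P.π.Nonempty) {k : ℕ} (hk : k ≤ P.nA)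
    {Wt : Sym2 (W × Site 2) → unitInterval} {p : unitInterval} {Δ : ℕ} {δ : ℝ}
    (hsub : KNLevels.IsSubbox (tubeGraph X P.π) Wt p (P.stepDR k)) (hfin : FinSupp Wt P.Sfin) (hDS : P.stepDR k ⊆ P.Sfin)
    (ho : P.root ∉ P.stepDR k) (hoS : P.root ∈ P.Sfin) (hj : P.j₁ ≤ P.Rlev)
    (hcount : 1 / (1 - (p : ℝ)) ^ (Δ * P.N) ≤ δ * ((Finset.Icc P.j₀ P.j₁).card : ℝ))
    (hkits : ∀ j ∈ Finset.Icc P.j₀ P.j₁, ∃ (σ : SData (W × Site 2)) (S : Finset (W × Site 2)),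
      SHyp (tubeLData X P.π (P.alo k) (P.ahi k) P.root P.Sfin) j σ ∧ σ.N ≤ P.N ∧
      (1 - (p : ℝ) ^ σ.sB) ^ σ.k ≤ δ ∧ S ⊆ (tubeLData X P.π (P.alo k) (P.ahi k) P.root P.Sfin).X j ∧ S ⊆ P.stepDR k ∧
      (∀ x ∈ σ.K, ∀ e ∈ σ.seed x, e ∉ wireSet (↑S : Set (W × Site 2))) ∧ (∀ x ∈ σ.K, σ.face x ⊆ S) ∧
      (∀ x ∈ σ.K, 1 - 3 * δ ≤ (prodBernoulli Wt).real {ω | ∃ u ∈ σ.face x,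
        1 - δ < (prodBernoulli (pinW Wt (wireSet (↑S : Set (W × Site 2))) ω)).real
          (⋃ t ∈ P.coreE k, openConnIn (↑(P.stepDR k) : Set (W × Site 2)) u t)})) :
    (P.stepAR X k).KitsAt Wt p Δ δ :=
  ⟨lhyp_tube X P.π (P.alo k) (P.ahi k) hsub hfin hDS (enclR X hsg hOK hRl hk) ho hoS, hj, coreER_subset_stepDR hsg hOK hRim hk,
    (coreT_nonempty hsg hOK hπ k).mono (P.coreT_subset_coreER X k), hcount, hkits⟩

omit hsg hOK in
omit [DecidableEq W] [X.LocallyFinite] in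
/-- **THE PLANAR ROOM OF THE ROOTED RUN** (p3-g2's `hroom`): for `k ≤ nA`, every level `j ≤ j₁` (`j₁ ≤ Rlev`, `Rlev + 1 ≤ R'`) and every
`v ∈ Icc (alo k - j) (ahi k + j)` there is `ℓ ∈ [ℓ₀, ℓ₁]` (any `ℓ₁ ≥ 2q + s₁ + R'`) with `(box 2 ℓ).image (· + v) ⊆ aregionR k` and a
quarter-face inside `acore (k + 1)`. [cite: KozmaNitzan2024, §4 Lemma 11 (pp. 22–23)] -/
theorem roomR (P : TubeAdvData W) (hsg : P.sg = 1 ∨ P.sg = -1) (hOK : Adv.AdvOK P.q P.q' P.s₁ P.ρ P.R' P.ℓ₀ P.nA)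
    (hRl : P.Rlev + 1 ≤ P.R') (hj : P.j₁ ≤ P.Rlev) {ℓ₁ : ℕ} (hℓ₁ : 2 * P.q + P.s₁ + P.R' ≤ ℓ₁) {k : ℕ} (hk : k ≤ P.nA) :
    ∀ j, j ≤ P.j₁ → ∀ v ∈ Finset.Icc (P.alo k - ((j : ℕ) : Site 2)) (P.ahi k + ((j : ℕ) : Site 2)), ∃ ℓ, P.ℓ₀ ≤ ℓ ∧ ℓ ≤ ℓ₁ ∧
      (box 2 ℓ).image (fun t => t + v) ⊆ P.aregionR k ∧
      ∃ (a : Fin 2) (τ' : Fin 2 → ℤˣ), (orthantFace a τ' ℓ).image (fun t => t + v) ⊆ P.acore (k + 1) := by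
  intro j hjj v hv
  rw [alo, ahi, sBox_enlarge _ _ hsg] at hv
  have hjR : (j : ℤ) ≤ P.R' := by exact_mod_cast (hjj.trans hj).trans (by omega : P.Rlev ≤ P.R')
  have hv' : v ∈ sBox P.ax P.sg P.c (Adv.coreα P.q P.s₁ k - P.R') (Adv.coreβ P.q P.s₁ k + P.R') (Adv.coreW P.q P.q' P.s₁ P.R' k + P.R') :=
    sBox_mono hsg _ (by linarith) (by linarith) (by linarith) hv
  obtain ⟨ℓ, hℓ0, hℓ1, hsq, τ, hface⟩ := Adv.core_routeR_le hsg P.c hOK hk hv'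
  have hℓ1' : ℓ ≤ ℓ₁ := by
    have : (ℓ : ℤ) ≤ ℓ₁ := hℓ1.trans hℓ₁
    exact_mod_cast this
  exact ⟨ℓ, hℓ0, hℓ1', hsq, P.ax, τ, hface⟩

/-- **THE ROOTED STRAIGHT RUN TRANSFERRED** (the elongated deep route of a face-step contact from its wired cube, Step IV's `h3`): the chain of
`nA + 1` rooted steps in the tube graph over `P.π` under a weighting `W'` with per-step facts, rim excess `≤ η ≤ δ/2`, a chain property of length
`nA + 1` at `(δ ↦ ε'')`, a source bound towards `B₀ ⊆ X^{(0)}_0`, the far face inside `Ft` and `P_{W'}(⋃ t ∈ Ft, root ↔ t) ≤ μA` give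
`1 - ε'' < μA`. [cite: KozmaNitzan2024, §4 Lemma 11 (pp. 22–23), Lemma 12 (pp. 23–25), p. 20 (Step IV)] -/
theorem lt_real_of_advRChain (hRl : P.Rlev + 1 ≤ P.R') (hRim : ∀ k, P.Rim k ⊆ P.stepDR k) (hπ : P.π.Nonempty)
    {p : unitInterval} {W' : Sym2 (W × Site 2) → unitInterval} {Ft B₀ : Finset (W × Site 2)} {μA : ℝ} {Δ' : ℕ} {δ ε'' η : ℝ}
    (hchain : ∀ (Wg : Sym2 (W × Site 2) → unitInterval) (s : Fin (P.nA + 1) → TStep (tubeGraph X P.π))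
      (T' : Fin (P.nA + 1) → Finset (W × Site 2)) (η : ℝ),
      (∀ i, (s i).L.o = (s 0).L.o) →
      (∀ i : Fin P.nA, T' (Fin.castSucc i) ⊆ (s i.succ).L.X 0) →
      (∀ i, T' i ⊆ (s i).T) →
      (∀ i, (s i).KitsAt Wg p Δ' δ) →
      η ≤ δ / 2 →
      (∀ i, (prodBernoulli Wg).real (⋃ t ∈ (s i).T \ T' i, openConn (s 0).L.o t) ≤ η) →
      1 - δ < (prodBernoulli Wg).real (s 0).L.reachB →
        1 - ε'' < (prodBernoulli Wg).real (⋃ t ∈ T' (Fin.last P.nA), openConn (s 0).L.o t))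
    (hsub : ∀ k ≤ P.nA, IsSubbox (tubeGraph X P.π) W' p (P.stepDR k)) (hfin : FinSupp W' P.Sfin)
    (hDS : ∀ k ≤ P.nA, P.stepDR k ⊆ P.Sfin) (ho : ∀ k ≤ P.nA, P.root ∉ P.stepDR k) (hoS : P.root ∈ P.Sfin) (hj : P.j₁ ≤ P.Rlev)
    (hcount : 1 / (1 - (p : ℝ)) ^ (Δ' * P.N) ≤ δ * ((Finset.Icc P.j₀ P.j₁).card : ℝ))
    (hkits : ∀ k ≤ P.nA, ∀ j ∈ Finset.Icc P.j₀ P.j₁, ∃ (σ : SData (W × Site 2)) (Sz : Finset (W × Site 2)),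
      SHyp (tubeLData X P.π (P.alo k) (P.ahi k) P.root P.Sfin) j σ ∧ σ.N ≤ P.N ∧
      (1 - (p : ℝ) ^ σ.sB) ^ σ.k ≤ δ ∧ Sz ⊆ (tubeLData X P.π (P.alo k) (P.ahi k) P.root P.Sfin).X j ∧ Sz ⊆ P.stepDR k ∧
      (∀ x ∈ σ.K, ∀ e ∈ σ.seed x, e ∉ wireSet (↑Sz : Set (W × Site 2))) ∧ (∀ x ∈ σ.K, σ.face x ⊆ Sz) ∧
      (∀ x ∈ σ.K, 1 - 3 * δ ≤ (prodBernoulli W').real {ω | ∃ u ∈ σ.face x,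
        1 - δ < (prodBernoulli (pinW W' (wireSet (↑Sz : Set (W × Site 2))) ω)).real
          (⋃ t ∈ P.coreE k, openConnIn (↑(P.stepDR k) : Set (W × Site 2)) u t)}))
    (hη : η ≤ δ / 2) (hexc : ∀ k ≤ P.nA, (prodBernoulli W').real (⋃ t ∈ P.Rim k, openConn P.root t) ≤ η)
    (hB₀ : B₀ ⊆ (P.stepL X 0).X 0) (hsrc : 1 - δ < (prodBernoulli W').real (⋃ t ∈ B₀, openConn P.root t))
    (hTn : P.coreT P.nA ⊆ Ft) (hdom : (prodBernoulli W').real (⋃ t ∈ Ft, openConn P.root t) ≤ μA) :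
    1 - ε'' < μA := by
  let s : Fin (P.nA + 1) → TStep (tubeGraph X P.π) := fun i => P.stepAR X i
  let T' : Fin (P.nA + 1) → Finset (W × Site 2) := fun i => P.coreT i
  have hle : ∀ i : Fin (P.nA + 1), (i : ℕ) ≤ P.nA := fun i => Nat.lt_succ_iff.1 i.2
  refine lt_real_of_chain (tubeGraph X P.π) hchain s T' (fun i => P.stepAR_o X i) (fun i => ?_) (fun i => P.coreT_subset_coreER X i)
    (fun i => ?_) hη (fun i => ?_) ?_ ?_ hdom
  · -- the true targets link the chain
    show P.coreT (Fin.castSucc i) ⊆ (P.stepAR X i.succ).L.X 0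
    have : ((i.succ : Fin (P.nA + 1)) : ℕ) = (Fin.castSucc i : ℕ) + 1 := by simp
    rw [show P.stepAR X (i.succ : ℕ) = P.stepAR X ((Fin.castSucc i : ℕ) + 1) by rw [this]]
    exact P.coreT_subset_XR_zero_succ X hsg _
  · exact kitsAt_stepAR X hsg hOK hRl hRim hπ (hle i) (hsub i (hle i)) hfin (hDS i (hle i)) (ho i (hle i)) hoS hj hcount
      (hkits i (hle i))
  · -- the excess of the enlarged target is inside the rim part
    refine le_trans (measureReal_mono ?_ (measure_ne_top _ _)) (hexc i (hle i))
    intro ω hω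
    simp only [Set.mem_iUnion, exists_prop] at hω ⊢
    obtain ⟨t, ht, hωt⟩ := hω
    exact ⟨t, P.coreER_sdiff_subset X i ht, hωt⟩
  · -- the source bound: `B₀ ⊆ X^{(0)}_0`
    show 1 - δ < (prodBernoulli W').real (P.stepAR X ((0 : Fin (P.nA + 1)) : ℕ)).L.reachB
    rw [Fin.val_zero]
    refine hsrc.trans_le (measureReal_mono ?_ (measure_ne_top _ _))
    intro ω hω
    simp only [Set.mem_iUnion, exists_prop] at hω
    obtain ⟨t, ht, hωt⟩ := hω
    show ω ∈ (P.stepL X 0).reachB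
    exact Set.mem_biUnion (Finset.mem_coe.2 (hB₀ ht)) hωt
  · -- the far face lies in `Ft`
    show P.coreT ((Fin.last P.nA : Fin (P.nA + 1)) : ℕ) ⊆ Ft
    rw [Fin.val_last]; exact hTn

end TubeAdvData

end BoxProdZ2

end Transplant

end Summit.CriticalPhenomena.PercolationContinuityZ3.Theorems

end
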